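import Summits.FinalStateConjecture.FinalStateConjecture.Theorems.CaptureSuffices.Negative.KerrMassPinning

/-!
# `CaptureSuffices` (crux `stmt-FinalStateConjecture-9953`, route `PhaseMixingCapture`):
# Kerr mass pinning at the CRITICAL Sobolev weight `δ ≥ -1/2`

Negative-side support file of the crux disprover (cdisprove seat); sequel of `KerrMassPinning.lean`
(which treats `δ ≥ 0`). In the convention of `WeightedNorms.lean` the `m = 0` term of the data distance
is `∫ (1 + ‖y‖)^{2δ} ‖h − h₀‖² dy`; for an `O(ΔM/‖y‖)` discrepancy in `ℝ³` this diverges exactly when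
`2δ − 2 + 2 ≥ −1`, i.e. `δ ≥ -1/2`. Proved here (no definitions, no named facts):

* `lintegral_eq_top_of_inv_cube_le` — `∫_{‖y‖ > R} ‖y‖⁻³ dy = ∞` in `ℝ³`: every dyadic annulus
  contributes the same positive amount (scaling of Lebesgue measure, `Measure.addHaar_closedBall`;
  additivity over the disjoint annuli by induction with `lintegral_union`);
* `dataWeightedSobolevEDist_kerr_eq_top_of_neg_half_le` — for `δ ≥ -1/2`, every `s`, spin `a` and
  truncation `r₀`, `Kerr.data M a r₀` and `Kerr.data M' a r₀` with `M ≠ M'` are at INFINITE distance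
  (pointwise input: `norm_hFun_sub_hFun_ge_kerr` of `KerrMassPinning.lean`, and
  `(1 + ‖y‖)^{2δ} ≥ (1 + ‖y‖)⁻¹ ≥ 1/(2‖y‖)` for `‖y‖ ≥ 1`); `kerr_not_mem_basin_of_neg_half_le` — the
  basin form.

So the threshold quoted in `AdversarialWitnesses.lean` / the crux work file is now certified on the
divergent side: any FIXED `δ` for the repaired capture items must satisfy `δ < -1/2` if their basins
are to contain data whose ADM mass differs from the reference Kerr mass (in print, Bartnik 1986 Thm 4.2:
finiteness of the `δ ≥ -1/2` distance forces equal ADM energy).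
-/

-- the problem namespace `FinalStateConjecture.FinalStateConjecture` (single-conjunct summit) trips dupNamespace
set_option linter.dupNamespace false

noncomputable section

open scoped Manifold ContDiff Topology ENNReal InnerProductSpace RealInnerProductSpace
open Set Filter MeasureTheory TopologicalSpace

namespace Summit.FinalStateConjecture.FinalStateConjecture.Theorems.CaptureSuffices.Negative

open Literature.Geometry.Lorentzian

/-! ### The critical weight: `δ ≥ -1/2` -/

/-- Divergence at the critical weight: on a set containing `{‖y‖ > R}` in `ℝ³` (`R > 0`), a
function bounded below by `κ / ‖y‖³` (`κ > 0`) has infinite Lebesgue integral — every dyadic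
annulus `{2ⁿR < ‖y‖ ≤ 2ⁿ⁺¹R}` contributes at least `7κ|B₁|/8`. -/
theorem lintegral_eq_top_of_inv_cube_le {κ R : ℝ} (hκ : 0 < κ) (hR : 0 < R) {U : Set E3}
    (hU : {y : E3 | R < ‖y‖} ⊆ U) {f : E3 → ℝ≥0∞}
    (hf : ∀ y : E3, R < ‖y‖ → ENNReal.ofReal (κ / ‖y‖ ^ 3) ≤ f y) :
    ∫⁻ y in U, f y = ⊤ := by
  set b : ℝ≥0∞ := volume (Metric.ball (0 : E3) 1) with hb
  have hb0 : b ≠ 0 :=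
    (Metric.isOpen_ball.measure_pos volume ⟨0, Metric.mem_ball_self one_pos⟩).ne'
  have hbtop : b ≠ ⊤ := measure_ball_lt_top.ne
  -- dyadic annuli and their partial unions
  set A : ℕ → Set E3 := fun n ↦
    Metric.closedBall 0 (2 ^ (n + 1) * R) \ Metric.closedBall 0 (2 ^ n * R) with hA
  set S : ℕ → Set E3 := fun n ↦ Metric.closedBall 0 (2 ^ n * R) \ Metric.closedBall 0 R with hS
  have hpow : ∀ n : ℕ, (1 : ℝ) ≤ 2 ^ n := fun n ↦ one_le_pow₀ (by norm_num)
  have hAm : ∀ n, MeasurableSet (A n) := fun n ↦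
    measurableSet_closedBall.diff measurableSet_closedBall
  have hSU : ∀ n, S n ⊆ U := by
    intro n y hy
    exact hU (lt_of_not_ge fun h ↦ hy.2 (mem_closedBall_zero_iff.2 h))
  have hSA : ∀ n, S n ∪ A n ⊆ S (n + 1) := by
    intro n y hy
    rcases hy with hy | hy
    · refine ⟨mem_closedBall_zero_iff.2 ?_, hy.2⟩
      have h1 : ‖y‖ ≤ 2 ^ n * R := mem_closedBall_zero_iff.1 hy.1
      have h2 : (2 : ℝ) ^ n * R ≤ 2 ^ (n + 1) * R := by
        rw [pow_succ]; nlinarith [hpow n]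
      exact h1.trans h2
    · refine ⟨hy.1, fun h ↦ hy.2 (mem_closedBall_zero_iff.2 ?_)⟩
      have h1 : ‖y‖ ≤ R := mem_closedBall_zero_iff.1 h
      nlinarith [hpow n]
  have hdisj : ∀ n, Disjoint (S n) (A n) := by
    intro n
    rw [Set.disjoint_left]
    intro y hyS hyA
    exact hyA.2 hyS.1
  -- each annulus contributes at least `c`
  set c : ℝ≥0∞ := ENNReal.ofReal (7 * κ / 8) * b with hc
  have hAc : ∀ n, c ≤ ∫⁻ y in A n, f y := by
    intro n
    set ρ : ℝ := 2 ^ n * R with hρ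
    have hρR : R ≤ ρ := le_mul_of_one_le_left hR.le (hpow n)
    have hρ0 : 0 < ρ := lt_of_lt_of_le hR hρR
    have hA' : A n = Metric.closedBall 0 (2 * ρ) \ Metric.closedBall 0 ρ := by
      simp only [hA, hρ, pow_succ]; ring_nf
    have hfA : ∀ y ∈ A n, ENNReal.ofReal (κ / (2 * ρ) ^ 3) ≤ f y := by
      intro y hy
      rw [hA'] at hy
      have hy1 : ‖y‖ ≤ 2 * ρ := mem_closedBall_zero_iff.1 hy.1
      have hy2 : ρ < ‖y‖ := lt_of_not_ge fun h ↦ hy.2 (mem_closedBall_zero_iff.2 h)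
      refine le_trans (ENNReal.ofReal_le_ofReal ?_) (hf y (lt_of_le_of_lt hρR hy2))
      exact div_le_div_of_nonneg_left hκ.le (pow_pos (hρ0.trans hy2) 3)
        (pow_le_pow_left₀ (norm_nonneg _) hy1 3)
    have hvol : ENNReal.ofReal (7 * ρ ^ 3) * b ≤ volume (A n) := by
      have h1 : volume (Metric.closedBall (0 : E3) (2 * ρ)) = ENNReal.ofReal ((2 * ρ) ^ 3) * b := by
        rw [Measure.addHaar_closedBall volume (0 : E3) (by positivity : (0 : ℝ) ≤ 2 * ρ),
          finrank_euclideanSpace_fin]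
      have h2 : volume (Metric.closedBall (0 : E3) ρ) = ENNReal.ofReal (ρ ^ 3) * b := by
        rw [Measure.addHaar_closedBall volume (0 : E3) hρ0.le, finrank_euclideanSpace_fin]
      calc ENNReal.ofReal (7 * ρ ^ 3) * b
          = ENNReal.ofReal ((2 * ρ) ^ 3 - ρ ^ 3) * b := by congr 1; ring_nf
        _ = (ENNReal.ofReal ((2 * ρ) ^ 3) - ENNReal.ofReal (ρ ^ 3)) * b := by
            rw [ENNReal.ofReal_sub _ (by positivity)]
        _ = ENNReal.ofReal ((2 * ρ) ^ 3) * b - ENNReal.ofReal (ρ ^ 3) * b := by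
            rw [ENNReal.sub_mul fun _ _ ↦ hbtop]
        _ = volume (Metric.closedBall (0 : E3) (2 * ρ)) - volume (Metric.closedBall (0 : E3) ρ) := by
            rw [h1, h2]
        _ ≤ volume (A n) := by rw [hA']; exact le_measure_sdiff
    have harith : c = ENNReal.ofReal (κ / (2 * ρ) ^ 3) * (ENNReal.ofReal (7 * ρ ^ 3) * b) := by
      rw [hc, ← mul_assoc, ← ENNReal.ofReal_mul (by positivity)]
      congr 2
      field_simp
      ring
    calc c = ENNReal.ofReal (κ / (2 * ρ) ^ 3) * (ENNReal.ofReal (7 * ρ ^ 3) * b) := harith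
      _ ≤ ENNReal.ofReal (κ / (2 * ρ) ^ 3) * volume (A n) := mul_le_mul' le_rfl hvol
      _ = ∫⁻ _ in A n, ENNReal.ofReal (κ / (2 * ρ) ^ 3) := (setLIntegral_const (A n) _).symm
      _ ≤ ∫⁻ y in A n, f y := setLIntegral_mono' (hAm n) hfA
  -- partial sums by induction
  have key : ∀ N : ℕ, c * N ≤ ∫⁻ y in S N, f y := by
    intro N
    induction N with
    | zero => simp
    | succ N ih =>
      calc c * ((N + 1 : ℕ) : ℝ≥0∞) = c * N + c := by push_cast; ring
        _ ≤ (∫⁻ y in S N, f y) + ∫⁻ y in A N, f y := add_le_add ih (hAc N)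
        _ = ∫⁻ y in S N ∪ A N, f y := (lintegral_union (hAm N) (hdisj N)).symm
        _ ≤ ∫⁻ y in S (N + 1), f y := lintegral_mono_set (hSA N)
  have hc0 : c ≠ 0 := by
    refine mul_ne_zero ?_ hb0
    rw [ne_eq, ENNReal.ofReal_eq_zero, not_le]
    positivity
  have : c * ⊤ ≤ ∫⁻ y in U, f y := by
    rw [← ENNReal.iSup_natCast, ENNReal.mul_iSup]
    exact iSup_le fun N ↦ (key N).trans (lintegral_mono_set (hSU N))
  rwa [ENNReal.mul_top hc0, top_le_iff] at this

/-- **Mass pinning at the critical weight, general spin.** For `δ ≥ -1/2` (the threshold at which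
`(1 + ‖y‖)^{2δ} · (ΔM/‖y‖)²` stops being integrable at infinity in `ℝ³`), every `s`, spin `a` and
truncation `r₀`, two Kerr–Schild data sets of the same spin and different masses are at INFINITE
`H^s_δ × H^{s-1}_{δ+1}` distance. Supersedes `dataWeightedSobolevEDist_kerr_eq_top` (`δ ≥ 0`). -/
theorem dataWeightedSobolevEDist_kerr_eq_top_of_neg_half_le [Kerr.Facts] [Kerr.SliceFacts]
    {M M' : ℝ} (hM : 0 ≤ M) (hM' : 0 ≤ M') (hne : M ≠ M') (a r₀ : ℝ) (s : ℕ) {δ : ℝ}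
    (hδ : -1 / 2 ≤ δ) :
    InitialDataSet.dataWeightedSobolevEDist s δ (Kerr.data M a r₀ hM) (Kerr.data M' a r₀ hM') = ⊤ := by
  set g := (Kerr.data M a r₀ hM).hFun - (Kerr.data M' a r₀ hM').hFun with hg
  have hMM : 0 < (M - M') ^ 2 / 2 := by
    have : M - M' ≠ 0 := sub_ne_zero.2 hne
    positivity
  have hR : 0 < Kerr.afRadius a r₀ + 2 * |a| + 1 := by
    have := Kerr.afRadius_pos a r₀; positivity
  have hdiv : ∫⁻ x in (Kerr.slice a r₀ : Set E3), ENNReal.ofReal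
      ((1 + ‖x‖) ^ (2 * (δ + ((0 : ℕ) : ℝ)) : ℝ) * ‖iteratedFDeriv ℝ 0 g x‖ ^ 2) = ⊤ := by
    refine lintegral_eq_top_of_inv_cube_le hMM hR (fun y hy ↦ Kerr.mem_slice_of_lt_norm ?_)
      fun y hy ↦ ?_
    · have : 0 ≤ 2 * |a| := by positivity
      exact lt_of_le_of_lt (by linarith) hy
    have hpos := Kerr.afRadius_pos a r₀
    have hya : 2 * |a| ≤ ‖y‖ := by linarith [hpos.le]
    have hyU : y ∈ Kerr.slice a r₀ :=
      Kerr.mem_slice_of_lt_norm (lt_of_le_of_lt (by linarith [abs_nonneg a]) hy)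
    have hy1 : 1 ≤ ‖y‖ := by linarith [abs_nonneg a, hpos.le]
    have hy0 : 0 < ‖y‖ := by linarith
    rw [norm_iteratedFDeriv_zero]
    refine ENNReal.ofReal_le_ofReal ?_
    have h1 : (1 + ‖y‖)⁻¹ ≤ (1 + ‖y‖) ^ (2 * (δ + ((0 : ℕ) : ℝ)) : ℝ) := by
      rw [← Real.rpow_neg_one]
      exact Real.rpow_le_rpow_of_exponent_le (by linarith) (by push_cast; linarith)
    have h1' : 1 / (2 * ‖y‖) ≤ (1 + ‖y‖)⁻¹ := by
      rw [one_div, inv_le_inv₀ (by positivity) (by positivity)]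
      linarith
    have hw : 1 / (2 * ‖y‖) ≤ (1 + ‖y‖) ^ (2 * (δ + ((0 : ℕ) : ℝ)) : ℝ) := h1'.trans h1
    have h2 : |M - M'| / ‖y‖ ≤ ‖g y‖ := by
      rw [hg, Pi.sub_apply]
      exact norm_hFun_sub_hFun_ge_kerr hM hM' hyU hya
    have hg2 : (M - M') ^ 2 / ‖y‖ ^ 2 ≤ ‖g y‖ ^ 2 := by
      rw [show (M - M') ^ 2 / ‖y‖ ^ 2 = (|M - M'| / ‖y‖) ^ 2 by rw [div_pow, sq_abs]]
      exact pow_le_pow_left₀ (by positivity) h2 2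
    calc (M - M') ^ 2 / 2 / ‖y‖ ^ 3 = 1 / (2 * ‖y‖) * ((M - M') ^ 2 / ‖y‖ ^ 2) := by
          field_simp
      _ ≤ (1 + ‖y‖) ^ (2 * (δ + ((0 : ℕ) : ℝ)) : ℝ) * ‖g y‖ ^ 2 :=
          mul_le_mul hw hg2 (by positivity) (le_trans (by positivity) hw)
  have hsemi : weightedSobolevSeminorm (Kerr.slice a r₀ : Set E3) s δ g = ⊤ := by
    unfold weightedSobolevSeminorm
    have hsum : ∑ m ∈ Finset.range (s + 1), ∫⁻ x in (Kerr.slice a r₀ : Set E3), ENNReal.ofReal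
        ((1 + ‖x‖) ^ (2 * (δ + m) : ℝ) * ‖iteratedFDeriv ℝ m g x‖ ^ 2) = ⊤ := by
      refine eq_top_iff.2 (le_trans (le_of_eq hdiv.symm) ?_)
      exact Finset.single_le_sum (f := fun m : ℕ ↦ ∫⁻ x in (Kerr.slice a r₀ : Set E3), ENNReal.ofReal
        ((1 + ‖x‖) ^ (2 * (δ + m) : ℝ) * ‖iteratedFDeriv ℝ m g x‖ ^ 2)) (fun _ _ ↦ zero_le)
        (Finset.mem_range.2 (Nat.succ_pos s))
    rw [hsum]
    exact ENNReal.top_rpow_of_pos (by norm_num)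
  unfold InitialDataSet.dataWeightedSobolevEDist
  rw [← hg, hsemi, top_add]


/-- **No basin around Kerr data contains Kerr data of another mass** (same spin, critical weight
`δ ≥ -1/2`). -/
theorem kerr_not_mem_basin_of_neg_half_le [Kerr.Facts] [Kerr.SliceFacts] {M M' : ℝ} (hM : 0 ≤ M)
    (hM' : 0 ≤ M') (hne : M' ≠ M) (a r₀ : ℝ) (s : ℕ) {δ : ℝ} (hδ : -1 / 2 ≤ δ) (ε : ℝ) :
    ¬ InitialDataSet.dataWeightedSobolevEDist s δ (Kerr.data M' a r₀ hM') (Kerr.data M a r₀ hM) <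
      ENNReal.ofReal ε := by
  rw [dataWeightedSobolevEDist_kerr_eq_top_of_neg_half_le hM' hM hne a r₀ s hδ]
  exact not_lt_of_ge le_top

end Summit.FinalStateConjecture.FinalStateConjecture.Theorems.CaptureSuffices.Negative
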